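import Summits.KontsevichZagierPeriods.KontsevichZagierPeriods.Theses.LiouvilleUnfolding
import Literature.NumberTheory.Transcendental.KZLogCalculusProofs
import Literature.NumberTheory.Transcendental.KZSemiCanonicalReductionProofs
import Literature.NumberTheory.Transcendental.KZDominatedFamilyRelations
import Literature.NumberTheory.Transcendental.SemialgebraicDerivativeProofs

/-!
# Sketch (crux-ideate, ideator 3, GEN 2): crux `UnfoldedLogStokes` (stmt-KontsevichZagierPeriods-2835)

Gen-2 additions on top of `SketchIdeator3.lean` (gen 1, same seat):

* §0 the standing disprover's `Disproof.lean` (published 2026-08-16T00:44Z, after the gen-1 cards) — the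
  load-bearing theorems both cards of this seat answer to (kernel-checked citations in `SketchDisproofCitations.lean`);
* §1 the SIGN/SHAPE bookkeeping of the transport line as a closed `abel` computation: the tree theorem's
  conclusion `of RB + of W − of Ub − of Ua` plus the three congruences and the `r₃` sign flip give the item's
  `of r₁ − of r₂ + of r₃ + of r₄` (checked against `Disproof.not_wrongSign`: the item's signs, not the flipped ones);
* §2 the sharpened first lemma of card `null-boundary-transport`: the general a.e.-congruence
  `of_congr_offNull` (domains equal up to null sets, integrands equal off a null semialgebraic set) — PROVED here
  from tree lemmas (`KZ.IntegralRep.of_sub_of_restrict_mem_relations`, `KZ.of_sub_of_mem_relations_of_eqOn`,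
  `KZ.of_mem_relations_of_volume_eq_zero`), and the gen-1 first lemma as its corollary;
* §3 the gen-1 first lemmas of both cards, restated (statements only, sorried; they must elaborate).
-/

noncomputable section

open MeasureTheory Set
open Literature.NumberTheory.Transcendental
open Literature.ModelTheory.ExponentialFields (IsSemialgebraic)

namespace Summit.KontsevichZagierPeriods.KontsevichZagierPeriods.Cruxes.UnfoldedLogStokes.Sketch3g2

variable {n m : ℕ}

/-! ## §0 The crux by name, and the Disproof theorems the two lines honour -/

example : Prop := Summit.KontsevichZagierPeriods.KontsevichZagierPeriods.Theses.LiouvilleUnfolding.UnfoldedLogStokes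

/- The Disproof citations (`example : ¬ Disproof.WithoutHab := Disproof.unfoldedLogStokes_false_without_hab`, …,
   `Disproof.not_wrongSign`) are kernel-checked in the companion file `SketchDisproofCitations.lean` (separate because the
   farm snapshot must first build `Cruxes/UnfoldedLogStokes/Disproof.lean`); names verified textually against the published
   file (namespace `…Cruxes.UnfoldedLogStokes.Disproof`, lines 387/515/593/657/724/791/973/982/992). -/

/-! ## §1 Sign/shape bookkeeping of the transport line (closed computation) -/

/-- The assembly of card `null-boundary-transport`: from the tree theorem's conclusion for the repaired
reps `(RB, W, Ub := r₂, Ua)` and the three rule-1 congruences, the item's combination follows by `abel`.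
`Ua` carries `−H(x,a x)/u`, so `of Ua + of r₃ ∈ relations` (`KZ.of_add_of_mem_relations_of_eqOn_neg`). -/
theorem transport_assembly (r₁ W : KZ.IntegralRep (n + 2)) (r₂ r₃ r₄ RB Ua : KZ.IntegralRep (n + 1))
    (hT : KZ.of RB + KZ.of W - KZ.of r₂ - KZ.of Ua ∈ KZ.relations)
    (hW : KZ.of r₁ - KZ.of W ∈ KZ.relations) (hRB : KZ.of r₄ - KZ.of RB ∈ KZ.relations)
    (hUa : KZ.of Ua + KZ.of r₃ ∈ KZ.relations) :
    KZ.of r₁ - KZ.of r₂ + KZ.of r₃ + KZ.of r₄ ∈ KZ.relations := by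
  have key : KZ.of r₁ - KZ.of r₂ + KZ.of r₃ + KZ.of r₄ =
      (KZ.of RB + KZ.of W - KZ.of r₂ - KZ.of Ua) + (KZ.of r₁ - KZ.of W) + (KZ.of r₄ - KZ.of RB) +
        (KZ.of Ua + KZ.of r₃) := by abel
  rw [key]
  exact KZ.relations.add_mem (KZ.relations.add_mem (KZ.relations.add_mem hT hW) hRB) hUa

/-! ## §2 Sharpened first lemma of `null-boundary-transport`: a.e.-congruence, proved -/

/-- **A.e.-congruence of KZ representations (gen-2 first lemma, PROVED).** If the domains of `r`, `r'`
agree up to Lebesgue-null sets and their integrands agree on the common domain off a null `ℚ`-semialgebraic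
set `N`, then `[r] − [r'] ∈ KZ.relations`: restrict both to `D := (r.domain ∩ r'.domain) \ N` (rule 1a; the
complements are null, `KZ.IntegralRep.of_sub_of_restrict_mem_relations`) and use congruence on `D`
(`KZ.of_sub_of_mem_relations_of_eqOn`). The class of a representation modulo moves depends only on the
a.e.-class of `1_domain · integrand` (within semialgebraic data). -/
theorem of_congr_offNull {r r' : KZ.IntegralRep n} (N : Set (Fin n → ℝ)) (hN : IsSemialgebraic ℚ N)
    (hN0 : volume N = 0) (h₁ : volume (r.domain \ r'.domain) = 0) (h₂ : volume (r'.domain \ r.domain) = 0)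
    (h : EqOn r.integrand r'.integrand ((r.domain ∩ r'.domain) \ N)) :
    KZ.of r - KZ.of r' ∈ KZ.relations := by
  set D : Set (Fin n → ℝ) := (r.domain ∩ r'.domain) \ N with hD
  have hDsa : IsSemialgebraic ℚ D :=
    (r.isSemialgebraic_domain.inter r'.isSemialgebraic_domain).diff hN
  have hDr : D ⊆ r.domain := fun z hz => hz.1.1
  have hDr' : D ⊆ r'.domain := fun z hz => hz.1.2
  have hvol : volume (r.domain \ D) = 0 := by
    apply measure_mono_null (t := (r.domain \ r'.domain) ∪ N)
    · intro z hz
      by_cases hzN : z ∈ N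
      · exact Or.inr hzN
      · by_cases hz' : z ∈ r'.domain
        · exact (hz.2 ⟨⟨hz.1, hz'⟩, hzN⟩).elim
        · exact Or.inl ⟨hz.1, hz'⟩
    · exact measure_union_null h₁ hN0
  have hvol' : volume (r'.domain \ D) = 0 := by
    apply measure_mono_null (t := (r'.domain \ r.domain) ∪ N)
    · intro z hz
      by_cases hzN : z ∈ N
      · exact Or.inr hzN
      · by_cases hz' : z ∈ r.domain
        · exact (hz.2 ⟨⟨hz', hz.1⟩, hzN⟩).elim
        · exact Or.inl ⟨hz.1, hz'⟩
    · exact measure_union_null h₂ hN0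
  have e1 := r.of_sub_of_restrict_mem_relations hDsa hDr hvol
  have e2 := r'.of_sub_of_restrict_mem_relations hDsa hDr' hvol'
  have e3 : KZ.of (r.restrict D hDsa hDr) - KZ.of (r'.restrict D hDsa hDr') ∈ KZ.relations :=
    KZ.of_sub_of_mem_relations_of_eqOn rfl (fun z hz => h hz)
  have key : KZ.of r - KZ.of r' = (KZ.of r - KZ.of (r.restrict D hDsa hDr)) +
      (KZ.of (r.restrict D hDsa hDr) - KZ.of (r'.restrict D hDsa hDr')) -
      (KZ.of r' - KZ.of (r'.restrict D hDsa hDr')) := by abel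
  rw [key]
  exact KZ.relations.sub_mem (KZ.relations.add_mem e1 e3) e2

/-- The gen-1 first lemma (same domain, agreement off a null semialgebraic set) is the special case. -/
theorem of_sub_of_mem_relations_of_eqOn_off_null {r r' : KZ.IntegralRep n}
    (N : Set (Fin n → ℝ)) (hN : IsSemialgebraic ℚ N) (hN0 : volume N = 0)
    (hd : r'.domain = r.domain) (h : EqOn r.integrand r'.integrand (r.domain \ N)) :
    KZ.of r - KZ.of r' ∈ KZ.relations :=
  of_congr_offNull N hN hN0 (by simp [hd]) (by simp [hd]) fun z hz => h ⟨hz.1.1, hz.2⟩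

/-- The null set along which the item's `r₄` (resp. `r₁`, after `KZ.volume_setOf_init_mem_eq_zero`) is repaired:
the two edge graphs of the band are Lebesgue-null (`KZ.volume_graph_eq_zero`, used twice). Statement only. -/
theorem volume_edgeGraphs_eq_zero {τ : Set (Fin n → ℝ)} {a b : (Fin n → ℝ) → ℝ} (hτ : IsSemialgebraic ℚ τ)
    (ha : IsSemialgebraicFunOn ℚ τ a) (hb : IsSemialgebraicFunOn ℚ τ b) :
    volume {z : Fin (n + 1) → ℝ | Fin.init z ∈ τ ∧
      (z (Fin.last n) = a (Fin.init z) ∨ z (Fin.last n) = b (Fin.init z))} = 0 := by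
  sorry

/-! ## §3 Gen-1 first lemmas of both cards (statements; see `SketchIdeator3.lean` for the dictionary `rfl`s) -/

/-- Card A glue: `H'' := r₁.integrand (·, 1)` is semialgebraic on the closed band (`V ≥ 1` puts `(z,1)` in
`r₁.domain`). -/
theorem isSemialgebraicFunOn_integrand_snoc_one {B : Set (Fin (n + 1) → ℝ)}
    {V : (Fin (n + 1) → ℝ) → ℝ} (hB : IsSemialgebraic ℚ B) (hV1 : ∀ z ∈ B, 1 ≤ V z)
    (r₁ : KZ.IntegralRep (n + 2)) (hd : r₁.domain = KZlog.band B (fun _ => 1) V) :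
    IsSemialgebraicFunOn ℚ B fun z => r₁.integrand (Fin.snoc z 1) := by
  sorry

/-- Card A glue: Tonelli converse (exact fibre `∫⁻_{[1,v]} ‖f/s‖ = ‖f log v‖` read backwards). -/
theorem integrableOn_mul_log_of_integrableOn_band {σ : Set (Fin m → ℝ)} {f v : (Fin m → ℝ) → ℝ}
    (hσ : IsSemialgebraic ℚ σ) (hf : IsSemialgebraicFunOn ℚ σ f) (hv : IsSemialgebraicFunOn ℚ σ v)
    (hv1 : ∀ y ∈ σ, 1 ≤ v y) (R : KZ.IntegralRep (m + 1))
    (hRd : R.domain = KZlog.band σ (fun _ => 1) v)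
    (hRi : EqOn R.integrand (fun z => f (Fin.init z) / z (Fin.last m)) R.domain) :
    IntegrableOn (fun y => f y * Real.log (v y)) σ := by
  sorry

/-- Card B first lemma: existential fibre substitution, integrability transported (no hypothesis on `f log v`). -/
theorem exists_fibreSubst {D : Set (Fin m → ℝ)} {f v : (Fin m → ℝ) → ℝ}
    (hD : IsSemialgebraic ℚ D) (hf : IsSemialgebraicFunOn ℚ D f) (hv : IsSemialgebraicFunOn ℚ D v)
    (hv1 : ∀ y ∈ D, 1 ≤ v y) (R₁ : KZ.IntegralRep (m + 1))
    (h₁d : R₁.domain = KZlog.band D (fun _ => 1) v)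
    (h₁i : EqOn R₁.integrand (fun z => f (Fin.init z) / z (Fin.last m)) R₁.domain) :
    ∃ R₂ : KZ.IntegralRep (m + 1), R₂.domain = KZlog.band D (fun _ => 0) (fun _ => 1) ∧
      EqOn R₂.integrand (fun z => f (Fin.init z) * (v (Fin.init z) - 1) /
        (1 + z (Fin.last m) * (v (Fin.init z) - 1))) R₂.domain ∧
      KZ.of R₁ - KZ.of R₂ ∈ KZ.relations := by
  sorry

/-- Card B: derivative-free `θ`-move written in `G := r₄.integrand` (`V'` never named). -/
theorem exists_boxTheta {B : Set (Fin (n + 1) → ℝ)} {G V : (Fin (n + 1) → ℝ) → ℝ}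
    (hB : IsSemialgebraic ℚ B) (hG : IsSemialgebraicFunOn ℚ B G) (hV : IsSemialgebraicFunOn ℚ B V)
    (hV1 : ∀ z ∈ B, 1 ≤ V z) (RB : KZ.IntegralRep (n + 1)) (hRBd : RB.domain = B)
    (hRBi : EqOn RB.integrand G RB.domain) :
    ∃ Rg₂ : KZ.IntegralRep (n + 2), Rg₂.domain = KZlog.band B (fun _ => 0) (fun _ => 1) ∧
      EqOn Rg₂.integrand (fun w => G (Fin.init w) * V (Fin.init w) /
        (1 + w (Fin.last (n + 1)) * (V (Fin.init w) - 1)) ^ 2) Rg₂.domain ∧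
      KZ.of Rg₂ - KZ.of RB ∈ KZ.relations := by
  sorry

end Summit.KontsevichZagierPeriods.KontsevichZagierPeriods.Cruxes.UnfoldedLogStokes.Sketch3g2
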